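import Literature.Topology.FourManifolds.PlumbingHomology
import Literature.Topology.FourManifolds.SphereCapComplement
import Literature.Topology.FourManifolds.SmoothOrientationProofs
import Literature.Topology.FourManifolds.RelFundamentalClassOfOrientation
import HarnessLib

/-!
# The plumbing `M(4m)` is simply connected and oriented; its relative fundamental class

Topic `Literature/Topology/FourManifolds`; part of the construction of Kosinski's `M(4m)`
(A. Kosinski, *Differential Manifolds* (1993), VI.12). The open plumbing `P = {ρ < ε}` (any
`ε > 0`; for `ε = 2` all of `P`) is covered by the eight tube pieces `Aᵥ ≃ Sᵏ`
(`Plumbing.pieceA`, `Plumbing.pieceTHomotopyEquiv`), adjacent ones meeting in contractible squares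
and three never meeting; van Kampen along the tree (`SphereCaps.isSimplyConnected_union_inter`,
Hatcher Lemma 1.15) gives:

* `Plumbing.isSimplyConnected_rho_lt`, `Plumbing.simplyConnectedSpace_PV` — `{ρ < ε}` and the
  plumbed manifold are simply connected (`k ≥ 2`);
* `Plumbing.orientationPV` — hence smoothly oriented (Lee 2013, Thm. 15.43,
  `isOrientable_of_simplyConnectedSpace_holds`), and `Plumbing.orientationWc` — the compact
  `M(4m) = {ρ ≤ ε}` is oriented by pulling back along the inclusion
  (`SmoothOrientation.comapOfDetNeZero`, `RegularSublevel.det_mfderiv_incl_ne_zero`);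
* `Plumbing.exists_isRelFundamentalClass` — `M(4m)` carries a relative fundamental class
  `[M(4m), ∂M(4m)] ∈ H_{n+1}(M(4m), ∂M(4m); ℤ)`
  (`NullCobordism.exists_isRelFundamentalClass_of_smoothOrientation`, Hatcher p. 253).

Everything is proved; no named facts (D-0026).

## References

* A. Kosinski, *Differential Manifolds*, Academic Press 1993, VI.12. [Kosinski1993]
* A. Hatcher, *Algebraic Topology*, CUP 2002, Lemma 1.15, §3.3 p. 253. [HatcherAT2002]
-/

open scoped Manifold ContDiff Topology RealInnerProductSpace
open Set Function Module Filter Metric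
open Literature.AlgebraicTopology.SingularHomology

noncomputable section

namespace Literature.Topology.FourManifolds

namespace Plumbing

open SphereCaps

/-- Local notation: `𝔼 n` is the model Euclidean space `EuclideanSpace ℝ (Fin n)`. -/
local notation "𝔼 " n:arg => EuclideanSpace ℝ (Fin n)

/-- Local notation: `𝕊 n` is the unit sphere in `EuclideanSpace ℝ (Fin (n + 1))`. -/
local notation "𝕊 " n:arg => (Metric.sphere (0 : EuclideanSpace ℝ (Fin (n + 1))) 1)

variable {k : ℕ} {c : ℝ} {n : ℕ} (hk : 2 ≤ k) (hc : IsParam c) (hkn : k + k = n + 1)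

/-! ### §1 The open plumbing is simply connected -/

/-- **The tube pieces `Aᵥ` are simply connected** (`Aᵥ ≃ Sᵏ`, `k ≥ 2`). [folklore] -/
theorem isSimplyConnected_pieceA (v : Fin 8) {ε : ℝ} (hε : 0 < ε) :
    IsSimplyConnected (pieceA hk hc hkn v ε) := by
  haveI := simplyConnectedSpace_sphere (E := 𝔼 (k + 1)) (n := k) hk
  haveI : SimplyConnectedSpace ↥(pieceT k c v ε) := (pieceTHomotopyEquiv hk hc v hε).simplyConnectedSpace_iff.2 ‹_›
  exact (pieceAHomeomorph hk hc hkn v ε).symm.toHomotopyEquiv.simplyConnectedSpace_iff.2 ‹_›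

/-- **Van Kampen along the tree for the open plumbing**: `A_0 ∪ ⋯ ∪ A_i` is simply connected.
[cite: Kosinski1993, VI.12 p. 122] -/
theorem isSimplyConnected_unionX {ε : ℝ} (hε : 0 < ε) :
    ∀ i : ℕ, i < 8 → IsSimplyConnected (unionX hk hc hkn i ε) := by
  intro i
  induction i with
  | zero =>
    intro _
    rw [unionX_zero]
    exact isSimplyConnected_pieceA hk hc hkn 0 hε
  | succ i ih =>
    intro hi
    rw [unionX_succ hk hc hkn hi]
    have h0 : (⟨i + 1, hi⟩ : Fin 8) ≠ 0 := by simp [Fin.ext_iff]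
    have h := isSimplyConnected_union_inter (L := univ) (O := unionX hk hc hkn i ε)
      (O' := pieceA hk hc hkn ⟨i + 1, hi⟩ ε) (isOpen_unionX hk hc hkn i ε) (isOpen_pieceA hk hc hkn _ ε)
      (by rw [inter_univ]; exact ih (by omega))
      (by rw [inter_univ]; exact isSimplyConnected_pieceA hk hc hkn _ hε)
      (by
        rw [inter_univ, unionX_inter_pieceA hk hc hkn hi]
        haveI := contractibleSpace_inter hk hc hkn (gamma8_par _ h0) hε
        exact isPathConnected_iff_pathConnectedSpace.2 inferInstance)
    rwa [inter_univ] at h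

/-- **`{ρ < ε}` is simply connected** for every `ε > 0` (`k ≥ 2`). [cite: Kosinski1993, VI.12 p. 122] -/
theorem isSimplyConnected_rho_lt {ε : ℝ} (hε : 0 < ε) :
    IsSimplyConnected {p : PV k c hk hc hkn | rho hk hc hkn p < ε} := by
  rw [← unionX_seven]
  exact isSimplyConnected_unionX hk hc hkn hε 7 (by norm_num)

/-- `ρ ≤ 1 < 2` everywhere. [folklore] -/
theorem rho_lt_two (p : PV k c hk hc hkn) : rho hk hc hkn p < 2 := by
  obtain ⟨v, x, rfl⟩ := exists_ι_eq hk hc hkn p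
  rw [rho_ι]
  have := (rhoHat_le_bFn hc v (x : (𝕊 k) × (𝕊 k))).trans (bFn_le_one _)
  linarith

/-- **The plumbed manifold is simply connected** (`k ≥ 2`). [cite: Kosinski1993, VI.12 p. 122] -/
theorem simplyConnectedSpace_PV : SimplyConnectedSpace (PV k c hk hc hkn) := by
  have h := isSimplyConnected_rho_lt hk hc hkn (ε := 2) two_pos
  have huniv : {p : PV k c hk hc hkn | rho hk hc hkn p < 2} = univ :=
    eq_univ_of_forall fun p => rho_lt_two hk hc hkn p
  rw [huniv] at h
  exact (Homeomorph.Set.univ (PV k c hk hc hkn)).toHomotopyEquiv.simplyConnectedSpace_iff.1 h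

/-! ### §2 Orientations -/

/-- **A smooth orientation of the plumbed manifold** (simply connected manifolds are
orientable, Lee 2013, Thm. 15.43). [cite: LeeSmoothManifolds2013, Thm. 15.43] -/
def orientationPV : SmoothOrientation (𝓡 (n + 1)) (PV k c hk hc hkn) :=
  haveI := simplyConnectedSpace_PV hk hc hkn
  Classical.choice isOrientable_of_simplyConnectedSpace_holds

variable {ε : ℝ} (hε : 0 < ε)

/-- **A smooth orientation of `M(4m) = {ρ ≤ ε}`**, pulled back from the plumbed manifold along
the inclusion (whose differential is invertible). [cite: HirschDT1976, §4.4 p. 101] -/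
def orientationWc : SmoothOrientation (𝓡∂ (n + 1)) (Wc hk hc hkn hε) :=
  (orientationPV hk hc hkn).comapOfDetNeZero (n := ∞) (Wc.incl hk hc hkn hε)
    (RegularSublevel.contMDiff_incl _) (by simp) (RegularSublevel.det_mfderiv_incl_ne_zero _)

/-! ### §3 The relative fundamental class -/

/-- **`M(4m)` has a relative fundamental class** `[M(4m), ∂M(4m)]` (a smoothly oriented compact
manifold with boundary; Hatcher 2002, §3.3 p. 253). [cite: HatcherAT2002, §3.3 p. 253] -/
theorem exists_isRelFundamentalClass (hε' : ε ≤ epsMax c) :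
    ∃ z : relativeSingularHomology ℤ ℤ (Wc.nullCobordism hk hc hkn hε hε').W
        ((𝓡∂ (n + 1)).boundary (Wc.nullCobordism hk hc hkn hε hε').W) (n + 1),
      IsRelFundamentalClass ℤ ((𝓡∂ (n + 1)).boundary (Wc.nullCobordism hk hc hkn hε hε').W) z := by
  obtain ⟨m, rfl⟩ : ∃ m, n = m + 1 := ⟨n - 1, by omega⟩
  haveI := compactSpace_bd hk hc hkn hε hε'
  exact NullCobordism.exists_isRelFundamentalClass_of_smoothOrientation (Wc.nullCobordism hk hc hkn hε hε')
    (orientationWc hk hc hkn hε)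

end Plumbing

end Literature.Topology.FourManifolds
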